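import Mathlib
import HarnessLib
import Literature.Analysis.FluidPDE.AxisymmetricReflection
import Literature.Analysis.FluidPDE.AxisymHouLiVariables

/-!
# Route `PoloidalWindowDoor`, item `LrcModEntire` (stmt-20428) / crux `PoloidalWindowRigidity` (stmt-19708) —
# jets of a slice field conjugated by a rotation about the vertical axis (toolkit for `…TwistingTHLocalRotation`)

Seat ns-poloidal-K2-p3 g9 (LEAD of item 20428; `--supports`).  For the rotation `R_θ` of `ℝ³` about `e₂` (tree `rotZ`,
`rotZLIE`) and a slice field `v : ℝ³ → ℝ³`, the Jacobian entries `∂′_j u′_i` of the conjugated field `u′ = R_θ ∘ v ∘ R_{−θ}`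
in the coordinate form used by the registered (TH) statements (`fderiv ℝ v x (EuclideanSpace.single j 1) i`): the vertical
row/column rotate like vectors (`jac_conj_02/12/22/20/21`), the horizontal block is conjugated by the planar rotation
(`jac_conj_00/11/01/10`); the vertical component, its gradient, its Laplacian and the gradient of `∂₂u′₂` are the composed
ones (`fderiv_conj_vert`, `laplacian_conj_vert`, `fderiv_conj_vertStrain`; tree `IsometryInvariance`); and the planar
linear algebra of the non-umbilic pin (`strain_unrotate`).  Pure calculus, no differentiability hypotheses (Mathlib's total
`fderiv` composes with linear equivalences unconditionally).

WHAT THIS IS NOT: not a statement about Navier–Stokes — bookkeeping lemmas for a free normalisation of a registered local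
statement (bears_on LADDER-NS N0 via 19708 / 20428).
-/

noncomputable section

-- the summit and its single sub-problem share the name (CONVENTIONS §1), as in every Theorems file
set_option linter.dupNamespace false

namespace Summit.NavierStokesRegularity.NavierStokesRegularity.Theorems.PoloidalWindowDoorLrcModEntireTwistingTHLocalRotationJets

open Set Function Filter Topology Metric
open scoped RealInnerProductSpace InnerProductSpace Laplacian
open Literature.Analysis Literature.Analysis.FluidPDE

/-! ### The planar rotation on the standard basis -/

/-- `R_{−θ} e₀ = cos θ e₀ − sin θ e₁`. [folklore] -/
theorem rotZ_neg_single_zero (θ : ℝ) :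
    rotZ (-θ) (EuclideanSpace.single 0 1 : EuclideanSpace ℝ (Fin 3)) =
      Real.cos θ • EuclideanSpace.single 0 1 + (-Real.sin θ) • EuclideanSpace.single 1 1 := by
  ext i
  fin_cases i <;> simp [Real.cos_neg, Real.sin_neg]

/-- `R_{−θ} e₁ = sin θ e₀ + cos θ e₁`. [folklore] -/
theorem rotZ_neg_single_one (θ : ℝ) :
    rotZ (-θ) (EuclideanSpace.single 1 1 : EuclideanSpace ℝ (Fin 3)) =
      Real.sin θ • EuclideanSpace.single 0 1 + Real.cos θ • EuclideanSpace.single 1 1 := by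
  ext i
  fin_cases i <;> simp [Real.cos_neg, Real.sin_neg]

/-- `R_{−θ} e₂ = e₂`. [folklore] -/
theorem rotZ_neg_single_two (θ : ℝ) :
    rotZ (-θ) (EuclideanSpace.single 2 1 : EuclideanSpace ℝ (Fin 3)) = EuclideanSpace.single 2 1 := by
  ext i
  fin_cases i <;> simp

/-! ### The conjugated slice field `y ↦ R_θ v(R_{−θ} y)`: its Jacobian entries -/

section Slice

variable (v : EuclideanSpace ℝ (Fin 3) → EuclideanSpace ℝ (Fin 3)) (θ : ℝ) (y : EuclideanSpace ℝ (Fin 3))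

/-- Chain rule: `D(R_θ v R_{−θ})(y)[e] = R_θ (Dv(R_{−θ}y)[R_{−θ}e])` (tree `fderiv_conj_linearIsometryEquiv`). [folklore] -/
theorem fderiv_conj_apply (e : EuclideanSpace ℝ (Fin 3)) :
    fderiv ℝ (fun z => rotZ θ (v (rotZ (-θ) z))) y e = rotZ θ (fderiv ℝ v (rotZ (-θ) y) (rotZ (-θ) e)) := by
  have h := fderiv_conj_linearIsometryEquiv (rotZLIE θ) v y
  simp only [rotZLIE_apply, rotZLIE_symm_apply] at h
  rw [h]
  rfl

/-- `∂′₀u′₂ = cos θ ∂₀u₂ − sin θ ∂₁u₂` (at the rotated point). [folklore] -/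
theorem jac_conj_02 :
    fderiv ℝ (fun z => rotZ θ (v (rotZ (-θ) z))) y (EuclideanSpace.single 0 1) 2 =
      Real.cos θ * fderiv ℝ v (rotZ (-θ) y) (EuclideanSpace.single 0 1) 2 -
        Real.sin θ * fderiv ℝ v (rotZ (-θ) y) (EuclideanSpace.single 1 1) 2 := by
  rw [fderiv_conj_apply, rotZ_apply_two, rotZ_neg_single_zero, map_add, map_smul, map_smul]
  simp only [PiLp.add_apply, PiLp.smul_apply, smul_eq_mul]
  ring

/-- `∂′₁u′₂ = sin θ ∂₀u₂ + cos θ ∂₁u₂`. [folklore] -/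
theorem jac_conj_12 :
    fderiv ℝ (fun z => rotZ θ (v (rotZ (-θ) z))) y (EuclideanSpace.single 1 1) 2 =
      Real.sin θ * fderiv ℝ v (rotZ (-θ) y) (EuclideanSpace.single 0 1) 2 +
        Real.cos θ * fderiv ℝ v (rotZ (-θ) y) (EuclideanSpace.single 1 1) 2 := by
  rw [fderiv_conj_apply, rotZ_apply_two, rotZ_neg_single_one, map_add, map_smul, map_smul]
  simp only [PiLp.add_apply, PiLp.smul_apply, smul_eq_mul]

/-- `∂′₂u′₂ = ∂₂u₂`. [folklore] -/
theorem jac_conj_22 :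
    fderiv ℝ (fun z => rotZ θ (v (rotZ (-θ) z))) y (EuclideanSpace.single 2 1) 2 =
      fderiv ℝ v (rotZ (-θ) y) (EuclideanSpace.single 2 1) 2 := by
  rw [fderiv_conj_apply, rotZ_apply_two, rotZ_neg_single_two]

/-- `∂′₂u′₀ = cos θ ∂₂u₀ − sin θ ∂₂u₁`. [folklore] -/
theorem jac_conj_20 :
    fderiv ℝ (fun z => rotZ θ (v (rotZ (-θ) z))) y (EuclideanSpace.single 2 1) 0 =
      Real.cos θ * fderiv ℝ v (rotZ (-θ) y) (EuclideanSpace.single 2 1) 0 -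
        Real.sin θ * fderiv ℝ v (rotZ (-θ) y) (EuclideanSpace.single 2 1) 1 := by
  rw [fderiv_conj_apply, rotZ_apply_zero, rotZ_neg_single_two]

/-- `∂′₂u′₁ = sin θ ∂₂u₀ + cos θ ∂₂u₁`. [folklore] -/
theorem jac_conj_21 :
    fderiv ℝ (fun z => rotZ θ (v (rotZ (-θ) z))) y (EuclideanSpace.single 2 1) 1 =
      Real.sin θ * fderiv ℝ v (rotZ (-θ) y) (EuclideanSpace.single 2 1) 0 +
        Real.cos θ * fderiv ℝ v (rotZ (-θ) y) (EuclideanSpace.single 2 1) 1 := by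
  rw [fderiv_conj_apply, rotZ_apply_one, rotZ_neg_single_two]

/-- `∂′₀u′₀ = c²∂₀u₀ − cs(∂₀u₁ + ∂₁u₀) + s²∂₁u₁`. [folklore] -/
theorem jac_conj_00 :
    fderiv ℝ (fun z => rotZ θ (v (rotZ (-θ) z))) y (EuclideanSpace.single 0 1) 0 =
      Real.cos θ ^ 2 * fderiv ℝ v (rotZ (-θ) y) (EuclideanSpace.single 0 1) 0 -
        Real.cos θ * Real.sin θ * (fderiv ℝ v (rotZ (-θ) y) (EuclideanSpace.single 0 1) 1 +
          fderiv ℝ v (rotZ (-θ) y) (EuclideanSpace.single 1 1) 0) +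
        Real.sin θ ^ 2 * fderiv ℝ v (rotZ (-θ) y) (EuclideanSpace.single 1 1) 1 := by
  rw [fderiv_conj_apply, rotZ_apply_zero, rotZ_neg_single_zero, map_add, map_smul, map_smul]
  simp only [PiLp.add_apply, PiLp.smul_apply, smul_eq_mul]
  ring

/-- `∂′₁u′₁ = s²∂₀u₀ + cs(∂₀u₁ + ∂₁u₀) + c²∂₁u₁`. [folklore] -/
theorem jac_conj_11 :
    fderiv ℝ (fun z => rotZ θ (v (rotZ (-θ) z))) y (EuclideanSpace.single 1 1) 1 =
      Real.sin θ ^ 2 * fderiv ℝ v (rotZ (-θ) y) (EuclideanSpace.single 0 1) 0 +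
        Real.cos θ * Real.sin θ * (fderiv ℝ v (rotZ (-θ) y) (EuclideanSpace.single 0 1) 1 +
          fderiv ℝ v (rotZ (-θ) y) (EuclideanSpace.single 1 1) 0) +
        Real.cos θ ^ 2 * fderiv ℝ v (rotZ (-θ) y) (EuclideanSpace.single 1 1) 1 := by
  rw [fderiv_conj_apply, rotZ_apply_one, rotZ_neg_single_one, map_add, map_smul, map_smul]
  simp only [PiLp.add_apply, PiLp.smul_apply, smul_eq_mul]
  ring

/-- `∂′₀u′₁ = cs(∂₀u₀ − ∂₁u₁) + c²∂₀u₁ − s²∂₁u₀`. [folklore] -/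
theorem jac_conj_01 :
    fderiv ℝ (fun z => rotZ θ (v (rotZ (-θ) z))) y (EuclideanSpace.single 0 1) 1 =
      Real.cos θ * Real.sin θ * (fderiv ℝ v (rotZ (-θ) y) (EuclideanSpace.single 0 1) 0 -
          fderiv ℝ v (rotZ (-θ) y) (EuclideanSpace.single 1 1) 1) +
        Real.cos θ ^ 2 * fderiv ℝ v (rotZ (-θ) y) (EuclideanSpace.single 0 1) 1 -
        Real.sin θ ^ 2 * fderiv ℝ v (rotZ (-θ) y) (EuclideanSpace.single 1 1) 0 := by
  rw [fderiv_conj_apply, rotZ_apply_one, rotZ_neg_single_zero, map_add, map_smul, map_smul]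
  simp only [PiLp.add_apply, PiLp.smul_apply, smul_eq_mul]
  ring

/-- `∂′₁u′₀ = cs(∂₀u₀ − ∂₁u₁) + c²∂₁u₀ − s²∂₀u₁`. [folklore] -/
theorem jac_conj_10 :
    fderiv ℝ (fun z => rotZ θ (v (rotZ (-θ) z))) y (EuclideanSpace.single 1 1) 0 =
      Real.cos θ * Real.sin θ * (fderiv ℝ v (rotZ (-θ) y) (EuclideanSpace.single 0 1) 0 -
          fderiv ℝ v (rotZ (-θ) y) (EuclideanSpace.single 1 1) 1) +
        Real.cos θ ^ 2 * fderiv ℝ v (rotZ (-θ) y) (EuclideanSpace.single 1 1) 0 -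
        Real.sin θ ^ 2 * fderiv ℝ v (rotZ (-θ) y) (EuclideanSpace.single 0 1) 1 := by
  rw [fderiv_conj_apply, rotZ_apply_zero, rotZ_neg_single_one, map_add, map_smul, map_smul]
  simp only [PiLp.add_apply, PiLp.smul_apply, smul_eq_mul]
  ring

/-- `D(g ∘ R_{−θ})(y)[e] = Dg(R_{−θ}y)[R_{−θ}e]` (tree `fderiv_comp_linearIsometryEquiv_symm`). [folklore] -/
theorem fderiv_comp_rotZ_neg (g : EuclideanSpace ℝ (Fin 3) → ℝ) (e : EuclideanSpace ℝ (Fin 3)) :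
    fderiv ℝ (fun z => g (rotZ (-θ) z)) y e = fderiv ℝ g (rotZ (-θ) y) (rotZ (-θ) e) := by
  have h := fderiv_comp_linearIsometryEquiv_symm (rotZLIE θ) g y
  simp only [rotZLIE_symm_apply] at h
  rw [h]
  rfl

/-- `Δ(g ∘ R_{−θ})(y) = Δg(R_{−θ}y)` (tree `laplacian_comp_linearIsometryEquiv_symm`). [folklore] -/
theorem laplacian_comp_rotZ_neg (g : EuclideanSpace ℝ (Fin 3) → ℝ) :
    Δ (fun z => g (rotZ (-θ) z)) y = Δ g (rotZ (-θ) y) := by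
  have h := laplacian_comp_linearIsometryEquiv_symm (rotZLIE θ) g y
  simp only [rotZLIE_symm_apply] at h
  exact h

/-- The vertical component of the conjugated field is `u₂ ∘ R_{−θ}`. [folklore] -/
theorem conj_vert_eq : (fun z => rotZ θ (v (rotZ (-θ) z)) 2) = fun z => (fun w => v w 2) (rotZ (-θ) z) := by
  funext z; rfl

/-- First derivative of the vertical component: `D(u′₂)(y)[e] = Du₂(R_{−θ}y)[R_{−θ}e]`. [folklore] -/
theorem fderiv_conj_vert (e : EuclideanSpace ℝ (Fin 3)) :
    fderiv ℝ (fun z => rotZ θ (v (rotZ (-θ) z)) 2) y e = fderiv ℝ (fun w => v w 2) (rotZ (-θ) y) (rotZ (-θ) e) := by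
  rw [conj_vert_eq]
  exact fderiv_comp_rotZ_neg θ y (fun w => v w 2) e

/-- The Laplacian of the vertical component: `Δu′₂(y) = Δu₂(R_{−θ}y)`. [folklore] -/
theorem laplacian_conj_vert :
    Δ (fun z => rotZ θ (v (rotZ (-θ) z)) 2) y = Δ (fun w => v w 2) (rotZ (-θ) y) := by
  rw [conj_vert_eq]
  exact laplacian_comp_rotZ_neg θ y (fun w => v w 2)

/-- The horizontal gradient of `∂₂u′₂` is the rotated one: `D(∂₂u′₂)(y)[e] = D(∂₂u₂)(R_{−θ}y)[R_{−θ}e]`. [folklore] -/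
theorem fderiv_conj_vertStrain (e : EuclideanSpace ℝ (Fin 3)) :
    fderiv ℝ (fun z => fderiv ℝ (fun z' => rotZ θ (v (rotZ (-θ) z'))) z (EuclideanSpace.single 2 1) 2) y e =
      fderiv ℝ (fun w => fderiv ℝ v w (EuclideanSpace.single 2 1) 2) (rotZ (-θ) y) (rotZ (-θ) e) := by
  have h : (fun z => fderiv ℝ (fun z' => rotZ θ (v (rotZ (-θ) z'))) z (EuclideanSpace.single 2 1) 2) =
      fun z => (fun w => fderiv ℝ v w (EuclideanSpace.single 2 1) 2) (rotZ (-θ) z) := by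
    funext z; rw [jac_conj_22]
  rw [h]
  exact fderiv_comp_rotZ_neg θ y (fun w => fderiv ℝ v w (EuclideanSpace.single 2 1) 2) e

end Slice

/-- Planar linear algebra of the non-umbilic pin: if the conjugated trace-free strain vanishes, so does the original
(`(D′, 2T′)` is `(D, 2T)` rotated by `2θ`). [folklore] -/
theorem strain_unrotate {c s p q m n : ℝ} (hc : c ^ 2 + s ^ 2 = 1) (hmn : m = n)
    (hD : c ^ 2 * p - c * s * (m + n) + s ^ 2 * q = s ^ 2 * p + c * s * (m + n) + c ^ 2 * q)
    (hT : c * s * (p - q) + c ^ 2 * n - s ^ 2 * m = 0) : p = q ∧ n = 0 := by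
  constructor
  · linear_combination (c ^ 2 - s ^ 2) * hD + 4 * c * s * hT - (c ^ 2 + s ^ 2 + 1) * (p - q) * hc +
      2 * c * s * (c ^ 2 + s ^ 2) * hmn
  · linear_combination -(c * s) * hD + (c ^ 2 - s ^ 2) * hT - (c ^ 2 + s ^ 2 + 1) * n * hc -
      s ^ 2 * (c ^ 2 + s ^ 2) * hmn

end Summit.NavierStokesRegularity.NavierStokesRegularity.Theorems.PoloidalWindowDoorLrcModEntireTwistingTHLocalRotationJets

end
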